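/-
Origin: written from primary sources — A. Weil, Acta Math. 111 (1964) Chap. III n° 39 p. 189 (continuity of the
metaplectic representation), S. Gelbart, J. Rogawski, Invent. Math. 105 (1991) §3.1 Prop. 3.1.1 p. 455 (the compatible
splitting is continuous), R. Howe (1979) §3 / S. Kudla (1984) §1 (see-saw). Adapted: no. This file is GLUE: continuity of
the inverse reindexing of record (`AdelicMetaplecticReindex`) in the coefficient topology, hence continuity of the three
pair splittings read on the see-saw group and of the `(12)` see-saw character of `UnitaryDualPairSeesawCharacter` along
continuous pair splittings. Kernel only; no records.
-/
import Literature.NumberTheory.GelbartRogawski1991.UnitaryDualPairSeesawCharacter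
import HarnessLib

-- buildfix G11b-3 recipe (LEDGER B13-1/B13-3): elaborate sequentially so the trailing `attribute [implicit_reducible]`
-- block (reducibilityCoreExt is keyed to the async environment branch) is in force at `.olean` export.
set_option Elab.async false

/-!
# Continuity of the `(12)` see-saw character at the splitting data of record

* `Weil1964.continuous_adelicMpReindex_symm` / `continuous_adelicMpContReindex_symm` — the inverse reindexing
  `Mp_ψ(W_{reindex e e T})ᶜᵒⁿᵗ ≃* Mp_ψ(W_T)ᶜᵒⁿᵗ` is continuous for the coefficient topologies (orbit maps of `π` move by
  `W_e^{±1}`, matrix coefficients by `R_e^{±1}`, both read pointwise);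
* `UnitaryDualPair.continuous_seesawBig' / continuous_seesawSmall₁ / continuous_seesawSmall₂` — along continuous pair
  splittings `s_pair` ([GelbartRogawski1991, Prop. 3.1.1]: the compatible splitting is continuous;
  `UnitaryDualPairThetaKernel.continuous_pairSplitting`);
* **`UnitaryDualPair.continuous_mpSeesawChar₁₂`** — `p ↦ χ₁₂(p) ∈ ℂ` is continuous on `U(J_V)(𝔸) × (U(J₁)(𝔸) × U(J₂)(𝔸))`
  (`continuous_mpSeesawCharSum`).

Provenance / use (Hodge-CM model-construction cell, node W2-Kn «K-norm»): continuity is what makes the archimedean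
`U(J_V)`-component of `χ₁₂` on each compact torus a power of `det` (`CircleCharacterClassification`,
`UnitaryGroupTorusCharactersIntegral`) — the integers `n_b` that the K-type normalisation of the pair splitting absorbs.
No continuity is claimed for the conjugated `(34)` character (`UnitaryDualPairSeesawConjCharacter`: conjugation by
`ω(r_F h₀)` is not coefficient-continuous).
-/

set_option autoImplicit false

noncomputable section

open scoped Matrix Kronecker
open NumberField
open Literature.RepresentationTheory.HeisenbergGroup
open Literature.NumberTheory.Automorphic
open Literature.NumberTheory.Automorphic.UnitaryGroup
open Literature.NumberTheory.Weil1964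

/-! ## §1 Continuity of the inverse reindexing of record -/

namespace Literature.NumberTheory.Weil1964

section ReindexSymm

variable (F : Type) [Field F] [NumberField F] {ι ι' : Type} [Fintype ι] [Fintype ι'] [DecidableEq ι]
  [DecidableEq ι'] (e : ι ≃ ι') (T : Matrix ι ι (AdeleRing (𝓞 F) F))

/-- **the inverse reindexing `Mp_ψ(W_{reindex e e T}) ≃* Mp_ψ(W_T)` is continuous** (coefficient topologies).
[cite: Weil1964, Chap. III n° 39 p. 189] -/
theorem continuous_adelicMpReindex_symm : Continuous (adelicMpReindex F e T).symm := by
  refine (continuous_into_adelicMp_iff _).2 ⟨fun v => ?_, fun Φ x => ?_⟩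
  · have hc := continuous_proj_apply (F := F) (ι := ι') (T := Matrix.reindex e e T) (reindexW (AdeleRing (𝓞 F) F) e v)
    have h : ∀ q : adelicMp F ι' (Matrix.reindex e e T),
        ((MpPsi.proj (adelicSchrodinger F ι T) ((adelicMpReindex F e T).symm q) :
            symplecticGroup (polar (adelicForm F ι T))) :
          ((ι → AdeleRing (𝓞 F) F) × (ι → AdeleRing (𝓞 F) F)) ≃ₗ[AdeleRing (𝓞 F) F]
            ((ι → AdeleRing (𝓞 F) F) × (ι → AdeleRing (𝓞 F) F))) v =
        ((((MpPsi.proj (adelicSchrodinger F ι' (Matrix.reindex e e T)) q :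
              symplecticGroup (polar (adelicForm F ι' (Matrix.reindex e e T)))) :
            ((ι' → AdeleRing (𝓞 F) F) × (ι' → AdeleRing (𝓞 F) F)) ≃ₗ[AdeleRing (𝓞 F) F]
              ((ι' → AdeleRing (𝓞 F) F) × (ι' → AdeleRing (𝓞 F) F))) (reindexW (AdeleRing (𝓞 F) F) e v)).1 ∘ e,
          (((MpPsi.proj (adelicSchrodinger F ι' (Matrix.reindex e e T)) q :
              symplecticGroup (polar (adelicForm F ι' (Matrix.reindex e e T)))) :
            ((ι' → AdeleRing (𝓞 F) F) × (ι' → AdeleRing (𝓞 F) F)) ≃ₗ[AdeleRing (𝓞 F) F]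
              ((ι' → AdeleRing (𝓞 F) F) × (ι' → AdeleRing (𝓞 F) F))) (reindexW (AdeleRing (𝓞 F) F) e v)).2 ∘ e) :=
      fun q => rfl
    simp only [h]
    exact (continuous_pi fun i => (continuous_apply _).comp (continuous_fst.comp hc)).prodMk
      (continuous_pi fun i => (continuous_apply _).comp (continuous_snd.comp hc))
  · have h : ∀ q : adelicMp F ι' (Matrix.reindex e e T),
        ((omegaPsi (adelicSchrodinger F ι T) ((adelicMpReindex F e T).symm q) Φ : piSchwartzBruhat F ι) :
          (ι → AdeleRing (𝓞 F) F) → ℂ) x =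
        ((omegaPsi (adelicSchrodinger F ι' (Matrix.reindex e e T)) q (piSBReindex F e Φ) : piSchwartzBruhat F ι') :
          (ι' → AdeleRing (𝓞 F) F) → ℂ) (x ∘ e.symm) := fun q => rfl
    simp only [h]
    exact continuous_omegaPsi_apply _ _

/-- **the inverse reindexing OF RECORD is continuous.** [cite: Weil1964, Chap. III n° 39 p. 189] -/
theorem continuous_adelicMpContReindex_symm : Continuous (adelicMpContReindex F e T).symm :=
  (continuous_into_adelicMpCont_iff _).2 ((continuous_adelicMpReindex_symm F e T).comp continuous_subtype_val)

end ReindexSymm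

end Literature.NumberTheory.Weil1964

/-! ## §2 Continuity of the pair splittings read on the see-saw group, and of `χ₁₂` -/

namespace Literature.NumberTheory.GelbartRogawski1991

namespace UnitaryDualPair

section Continuity

variable (F E : Type) [Field F] [NumberField F] [Field E] [NumberField E] [Algebra F E]
variable (c : E ≃ₐ[F] E) (N M₁ M₂ : ℕ) {n n₁ n₂ : ℕ}
  (eW : Fin N × Fin (M₁ + M₂) ≃ Fin n) (e₁ : Fin N × Fin M₁ ≃ Fin n₁) (e₂ : Fin N × Fin M₂ ≃ Fin n₂)
variable (JV : Matrix (Fin N) (Fin N) E) (J₁ : Matrix (Fin M₁) (Fin M₁) E) (J₂ : Matrix (Fin M₂) (Fin M₂) E)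
variable {TV : Matrix (Fin N) (Fin N) F} {T₁ : Matrix (Fin M₁) (Fin M₁) F} {T₂ : Matrix (Fin M₂) (Fin M₂) F}

/-- `seesawBig s` is continuous along a continuous pair splitting. [cite: GelbartRogawski1991, §3.1 Prop. 3.1.1 p. 455] -/
theorem continuous_seesawBig' {s : adelicPair F E c N (M₁ + M₂) JV (finSum M₁ M₂ J₁ J₂) →*
      adelicMpCont F (Fin n) (adelicGram F eW TV (finSum M₁ M₂ T₁ T₂))}
    (hc : Continuous (pairSplitting F E c N (M₁ + M₂) eW JV (finSum M₁ M₂ J₁ J₂) s)) :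
    Continuous (seesawBig F E c N M₁ M₂ eW JV J₁ J₂ s) :=
  continuous_seesawBig F E c N M₁ M₂ eW JV J₁ J₂ hc (continuous_adelicMpContReindex_symm F eW _)

/-- `seesawSmall₁ s₁` is continuous along a continuous pair splitting. [cite: GelbartRogawski1991, §3.1 Prop. 3.1.1 p. 455] -/
theorem continuous_seesawSmall₁ {s₁ : adelicPair F E c N M₁ JV J₁ →* adelicMpCont F (Fin n₁) (adelicGram F e₁ TV T₁)}
    (hc₁ : Continuous (pairSplitting F E c N M₁ e₁ JV J₁ s₁)) :
    Continuous (seesawSmall₁ F E c N M₁ M₂ e₁ JV J₁ J₂ s₁) :=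
  (continuous_adelicMpContReindex_symm F e₁ _).comp
    (hc₁.comp (continuous_id.prodMap continuous_fst))

/-- `seesawSmall₂ s₂` is continuous along a continuous pair splitting. [cite: GelbartRogawski1991, §3.1 Prop. 3.1.1 p. 455] -/
theorem continuous_seesawSmall₂ {s₂ : adelicPair F E c N M₂ JV J₂ →* adelicMpCont F (Fin n₂) (adelicGram F e₂ TV T₂)}
    (hc₂ : Continuous (pairSplitting F E c N M₂ e₂ JV J₂ s₂)) :
    Continuous (seesawSmall₂ F E c N M₁ M₂ e₂ JV J₁ J₂ s₂) :=
  (continuous_adelicMpContReindex_symm F e₂ _).comp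
    (hc₂.comp (continuous_id.prodMap continuous_snd))

variable [Algebra.IsQuadraticExtension F E] {δ : E} (hcδ : c δ = -δ) (hδ : δ ≠ 0) {d : F}
  (hd : δ * δ = algebraMap F E d) (hV : TV.IsSymm) (h₁ : T₁.IsSymm) (h₂ : T₂.IsSymm) (hVd : IsUnit TV.det)
  (h₁d : IsUnit T₁.det) (h₂d : IsUnit T₂.det) (hWd : IsUnit (finSum M₁ M₂ T₁ T₂).det)
  (hJV : JV = TV.map (algebraMap F E)) (hJ₁ : J₁ = T₁.map (algebraMap F E)) (hJ₂ : J₂ = T₂.map (algebraMap F E))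
  {s : adelicPair F E c N (M₁ + M₂) JV (finSum M₁ M₂ J₁ J₂) →*
    adelicMpCont F (Fin n) (adelicGram F eW TV (finSum M₁ M₂ T₁ T₂))}
  {s₁ : adelicPair F E c N M₁ JV J₁ →* adelicMpCont F (Fin n₁) (adelicGram F e₁ TV T₁)}
  {s₂ : adelicPair F E c N M₂ JV J₂ →* adelicMpCont F (Fin n₂) (adelicGram F e₂ TV T₂)}

/-- **`χ₁₂` is continuous** along continuous pair splittings `s_pair`, `s_{1,pair}`, `s_{2,pair}` (coefficient
topologies; [GelbartRogawski1991, Prop. 3.1.1] supplies the continuity of compatible splittings).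
[cite: Weil1964, Chap. III n° 39 p. 189] -/
theorem continuous_mpSeesawChar₁₂
    (hs : (splittingDatum F E c N (M₁ + M₂) eW JV (finSum M₁ M₂ J₁ J₂) hcδ hδ hd hV (isSymm_finSum h₁ h₂) hVd hWd hJV
      (finSum_eq_map_finSum F E M₁ M₂ J₁ J₂ hJ₁ hJ₂)).IsCompatible s)
    (hs₁ : (splittingDatum F E c N M₁ e₁ JV J₁ hcδ hδ hd hV h₁ hVd h₁d hJV hJ₁).IsCompatible s₁)
    (hs₂ : (splittingDatum F E c N M₂ e₂ JV J₂ hcδ hδ hd hV h₂ hVd h₂d hJV hJ₂).IsCompatible s₂)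
    (hc : Continuous (pairSplitting F E c N (M₁ + M₂) eW JV (finSum M₁ M₂ J₁ J₂) s))
    (hc₁ : Continuous (pairSplitting F E c N M₁ e₁ JV J₁ s₁))
    (hc₂ : Continuous (pairSplitting F E c N M₂ e₂ JV J₂ s₂)) :
    Continuous fun p : adelic F E c N JV × (adelic F E c M₁ J₁ × adelic F E c M₂ J₂) =>
      (mpSeesawChar₁₂ F E c N M₁ M₂ eW e₁ e₂ JV J₁ J₂ hcδ hδ hd hV h₁ h₂ hVd h₁d h₂d hWd hJV hJ₁ hJ₂ hs hs₁ hs₂ p : ℂ) :=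
  continuous_mpSeesawCharSum (finProdSumEquiv N M₁ M₂) (reindex_gram_finSum F N M₁ M₂) _ _ _
    (hS_seesaw F E c N M₁ M₂ eW e₁ e₂ JV J₁ J₂ hcδ hδ hd hV h₁ h₂ hVd h₁d h₂d hWd hJV hJ₁ hJ₂ hs hs₁ hs₂) _ _
    (continuous_seesawBig' F E c N M₁ M₂ eW JV J₁ J₂ hc) (continuous_seesawSmall₁ F E c N M₁ M₂ e₁ JV J₁ J₂ hc₁)
    (continuous_seesawSmall₂ F E c N M₁ M₂ e₂ JV J₁ J₂ hc₂)

end Continuity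

/-! ### Build-lane note (ops-buildfix G11b-3 recipe, LEDGER B13-1, 2026-08-21)
`lean -o` (the hub build lane, never `lean`/the gate check) runs Lean 4.32's library-suggestion indexers
(`Lean.LibrarySuggestions.SymbolFrequency` / `SineQuaNon`, from their `exportEntriesFn`) over the statement of
every local theorem that is not a denied premise; on this family's statements (very large dependent binder
telescopes through the theta-kernel / dual-pair data) that fold runs for tens of minutes to hours and the build
lane kills the job (incident G11b-3, run/shared/lean/ops/buildfix/G11b-3-DOSSIER.md). `isDeniedPremise` skips
`[implicit_reducible]` constants before any fold, and a reducibility status on a *theorem* is inert (Meta never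
unfolds `thmInfo`; the kernel ignores the attribute), so the public theorems of this file are tagged
`[implicit_reducible]` purely to keep them out of that index. Only other effect: they are not offered by
`+suggestions` premise selectors. No statement or proof is changed; superseded if the operator lands a
deny-list form (`HarnessLib.PremiseIndex`). -/
set_option allowUnsafeReducibility true in
attribute [implicit_reducible]
  _root_.Literature.NumberTheory.Weil1964.continuous_adelicMpReindex_symm
  _root_.Literature.NumberTheory.Weil1964.continuous_adelicMpContReindex_symm continuous_seesawBig'
  continuous_seesawSmall₁ continuous_seesawSmall₂ continuous_mpSeesawChar₁₂

end UnitaryDualPair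

end Literature.NumberTheory.GelbartRogawski1991

end
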